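import Summits.CriticalPhenomena.PercolationContinuityZ3.Theorems.PercNearOneGluingNoHeavyLowerTailQ44OddContainment

/-!
# The handshake kernel: an odd GF(2) certificate from a maximal member and the parity of a covering graph

Support file for crux `stmt-CriticalPhenomena-4575` (master-family programme, quadratic four-point row `Q44`; single-source
packing), seat `prim-bnk-1` gen 27; memo `run/shared/lean/prim/prim-l12/FROM-prim-bnk-1-gen27-SINGLE-SOURCE-ANATOMY.md` §5d.

`…Q44OddContainment` reduced an odd target (a good containing an odd number of members of a family `𝒮`) to a kernel `K`
contained in an ODD number of members with all `S ∪ Kᶜ` good.  For the residual case of the single-source packing (K2-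
against K4s-sides, memo §5d) the kernels are `K_X = A₀ ∪ (X₀ \ X)`, where `X₀` is a maximal member, `A₀ ⊆ X₀` a fixed part
(the `ab`-component of `X₀`) and `X` runs over the members containing `A₀`; graph theory shows that EVERY `K_X` is a valid
kernel.  Which one has odd containment count is then pure parity, proved here in the abstract:

* `exists_even_filter_card_of_card_odd` — HANDSHAKE LEMMA: on a finite set of odd size, a symmetric irreflexive relation
  has a vertex of even degree (`Finset.sum_involution` in `ZMod 2`);
* `exists_odd_good_of_handshake` — **the handshake kernel theorem**: `𝔊` an up-set, `X₀ ∈ 𝒮` with no other member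
  containing it, `A₀ ⊆ X₀`, and `S ∪ (A₀ ∪ (X₀ \ X))ᶜ ∈ 𝔊` for all members `S` and all members `X ⊇ A₀`.  Then some
  `T ∈ 𝔊` contains an odd number of members of `𝒮`.  (Dichotomy: if the number of members containing `A₀` is odd, `K = A₀`
  works; otherwise the members `X ≠ X₀` containing `A₀` form an odd set on which `X ~ X' ⟺ X₀ ⊆ X ∪ X'` is a loop-free
  symmetric relation, the containment count of `K_X` is `1 + deg X`, and the handshake lemma supplies an `X` of even degree.)

Pure finite combinatorics; no named facts, no sorries, standard axioms.  The graph-theoretic verification of the validity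
hypothesis for K2/K4s families (memo §5d: `A₀` = edge set of the component of `a` in `X₀`; c–y paths avoid it) and the
assembly of the law `K2+K5+K4s+ab+ac` through `pack_of_graphFibreCount` are the next files.
-/

namespace Summit.CriticalPhenomena.PercolationContinuityZ3.Theorems

namespace KernelPeeling

open Finset

/-- **Handshake lemma (parity form).**  If `V` is a finite set of odd size and `r` is symmetric and irreflexive on `V`, then
some `x ∈ V` is `r`-related to an even number of elements of `V`. [folklore] -/
theorem exists_even_filter_card_of_card_odd {β : Type*} [DecidableEq β] (V : Finset β) (r : β → β → Prop)
    [DecidableRel r] (hsymm : ∀ x ∈ V, ∀ y ∈ V, r x y → r y x) (hirr : ∀ x ∈ V, ¬ r x x) (hodd : Odd #V) :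
    ∃ x ∈ V, Even #(V.filter (fun y => r x y)) := by
  classical
  by_contra hcon
  simp only [not_exists, not_and] at hcon
  have hall : ∀ x ∈ V, Odd #(V.filter (fun y => r x y)) := fun x hx => Nat.not_even_iff_odd.1 (hcon x hx)
  -- the indicator of `r` on `V × V` sums to zero in `ZMod 2` (fixed-point-free involution `Prod.swap`)
  set f : β × β → ZMod 2 := fun p => if r p.1 p.2 then 1 else 0 with hf
  have hzero : ∑ p ∈ V ×ˢ V, f p = 0 := by
    refine Finset.sum_involution (fun p _ => p.swap) ?_ ?_ ?_ ?_
    · intro p hp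
      rw [Finset.mem_product] at hp
      simp only [hf, Prod.fst_swap, Prod.snd_swap]
      by_cases h : r p.1 p.2
      · have h' : r p.2 p.1 := hsymm p.1 hp.1 p.2 hp.2 h
        rw [if_pos h, if_pos h']; decide
      · have h' : ¬ r p.2 p.1 := fun h'' => h (hsymm p.2 hp.2 p.1 hp.1 h'')
        rw [if_neg h, if_neg h']; decide
    · intro p hp hne
      rw [Finset.mem_product] at hp
      simp only [hf] at hne
      have h : r p.1 p.2 := by
        by_contra h0; exact hne (by rw [if_neg h0])
      intro heq
      have h12 : p.1 = p.2 := by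
        have := congrArg Prod.fst heq
        simpa using this.symm
      exact hirr p.1 hp.1 (by rw [h12] at h ⊢; exact h)
    · intro p hp
      rw [Finset.mem_product] at hp ⊢
      exact ⟨hp.2, hp.1⟩
    · intro p _
      exact Prod.swap_swap p
  -- but row by row every row sum is odd, and there is an odd number of rows
  have hrows : ∑ p ∈ V ×ˢ V, f p = ∑ x ∈ V, ((#(V.filter (fun y => r x y)) : ℕ) : ZMod 2) := by
    rw [Finset.sum_product]
    refine Finset.sum_congr rfl fun x _ => ?_
    simp only [hf]
    rw [Finset.sum_boole]
  have hone : ∀ x ∈ V, (((#(V.filter (fun y => r x y)) : ℕ) : ZMod 2)) = 1 :=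
    fun x hx => (ZMod.natCast_eq_one_iff_odd).2 (hall x hx)
  have hsum : ∑ x ∈ V, ((#(V.filter (fun y => r x y)) : ℕ) : ZMod 2) = ((#V : ℕ) : ZMod 2) := by
    rw [Finset.sum_congr rfl hone, Finset.sum_const, nsmul_eq_mul, mul_one]
  have hV : ((#V : ℕ) : ZMod 2) = 1 := (ZMod.natCast_eq_one_iff_odd).2 hodd
  rw [hrows, hsum, hV] at hzero
  exact one_ne_zero hzero

variable {α : Type*} [DecidableEq α] [Fintype α]

/-- **The handshake kernel theorem.**  Let `𝔊` be an up-set and `𝒮` a family with a member `X₀` contained in no other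
member, and let `A₀ ⊆ X₀`.  Suppose that for every member `X ⊇ A₀` the kernel `A₀ ∪ (X₀ \ X)` is valid:
`S ∪ (A₀ ∪ (X₀ \ X))ᶜ ∈ 𝔊` for all `S ∈ 𝒮`.  Then some `T ∈ 𝔊` contains an odd number of members of `𝒮`. [this work] -/
theorem exists_odd_good_of_handshake (𝔊 : Finset (Finset α)) (hG : IsUpperSet (𝔊 : Set (Finset α)))
    (𝒮 : Finset (Finset α)) (A₀ X₀ : Finset α) (hX₀ : X₀ ∈ 𝒮) (hA : A₀ ⊆ X₀)
    (hmax : ∀ S ∈ 𝒮, X₀ ⊆ S → S = X₀)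
    (hval : ∀ X ∈ 𝒮, A₀ ⊆ X → ∀ S ∈ 𝒮, S ∪ (A₀ ∪ (X₀ \ X))ᶜ ∈ 𝔊) :
    ∃ T ∈ 𝔊, Odd #(𝒮.filter (fun S => S ⊆ T)) := by
  classical
  set 𝒜 : Finset (Finset α) := 𝒮.filter (fun X => A₀ ⊆ X) with h𝒜
  have hX₀𝒜 : X₀ ∈ 𝒜 := Finset.mem_filter.2 ⟨hX₀, hA⟩
  -- `X₀ \ X ⊆ S ↔ X₀ ⊆ X ∪ S`
  have hsd : ∀ X S : Finset α, X₀ \ X ⊆ S ↔ X₀ ⊆ X ∪ S := by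
    intro X S
    constructor
    · intro h x hx
      by_cases hxX : x ∈ X
      · exact Finset.mem_union_left _ hxX
      · exact Finset.mem_union_right _ (h (Finset.mem_sdiff.2 ⟨hx, hxX⟩))
    · intro h x hx
      rw [Finset.mem_sdiff] at hx
      rcases Finset.mem_union.1 (h hx.1) with h1 | h1
      · exact absurd h1 hx.2
      · exact h1
  -- containment count of the kernel `A₀ ∪ (X₀ \ X)`
  have hcount : ∀ X : Finset α, 𝒮.filter (fun S => A₀ ∪ (X₀ \ X) ⊆ S) = 𝒜.filter (fun S => X₀ ⊆ X ∪ S) := by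
    intro X
    ext S
    simp only [h𝒜, Finset.mem_filter, Finset.union_subset_iff, hsd X S]
    tauto
  by_cases hpar : Odd #𝒜
  · -- Case 1: `K = A₀`
    refine exists_odd_good_of_oddCount 𝔊 hG 𝒮 (A₀ ∪ (X₀ \ X₀)) ?_ (hval X₀ hX₀ hA)
    rw [hcount X₀]
    have hEq : 𝒜.filter (fun S => X₀ ⊆ X₀ ∪ S) = 𝒜 :=
      Finset.filter_true_of_mem fun S _ => Finset.subset_union_left
    rw [hEq]; exact hpar
  · -- Case 2: handshake on `V = 𝒜 \ {X₀}`
    have heven : Even #𝒜 := Nat.not_odd_iff_even.1 hpar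
    set V : Finset (Finset α) := 𝒜.erase X₀ with hV
    have hVcard : #V + 1 = #𝒜 := by rw [hV]; exact Finset.card_erase_add_one hX₀𝒜
    have hVodd : Odd #V := by
      rcases heven with ⟨t, ht⟩
      have h1 : 1 ≤ #𝒜 := Finset.card_pos.2 ⟨X₀, hX₀𝒜⟩
      refine ⟨t - 1, ?_⟩
      omega
    obtain ⟨X, hXV, hXeven⟩ := exists_even_filter_card_of_card_odd V (fun X Y => X ≠ Y ∧ X₀ ⊆ X ∪ Y)
      (fun X _ Y _ h => ⟨fun h' => h.1 h'.symm, by rw [Finset.union_comm]; exact h.2⟩)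
      (fun X hX h => by
        have hXX : X₀ ⊆ X := by have := h.2; rwa [Finset.union_idempotent] at this
        have hXS : X ∈ 𝒮 := (Finset.mem_filter.1 (Finset.mem_of_mem_erase hX)).1
        exact (Finset.ne_of_mem_erase hX) (hmax X hXS hXX))
      hVodd
    have hX𝒜 : X ∈ 𝒜 := Finset.mem_of_mem_erase hXV
    have hXS : X ∈ 𝒮 := (Finset.mem_filter.1 hX𝒜).1
    have hXA : A₀ ⊆ X := (Finset.mem_filter.1 hX𝒜).2
    have hXne : X ≠ X₀ := Finset.ne_of_mem_erase hXV
    refine exists_odd_good_of_oddCount 𝔊 hG 𝒮 (A₀ ∪ (X₀ \ X)) ?_ (hval X hXS hXA)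
    rw [hcount X]
    -- the members `S ⊇ A₀` with `X₀ ⊆ X ∪ S` are `X₀` and the `~`-neighbours of `X` in `V`
    have hEq : 𝒜.filter (fun S => X₀ ⊆ X ∪ S) = insert X₀ (V.filter (fun Y => X ≠ Y ∧ X₀ ⊆ X ∪ Y)) := by
      ext S
      simp only [Finset.mem_filter, Finset.mem_insert, hV, Finset.mem_erase]
      constructor
      · rintro ⟨hS𝒜, hsub⟩
        by_cases hS : S = X₀
        · exact Or.inl hS
        · refine Or.inr ⟨⟨hS, hS𝒜⟩, ?_, hsub⟩
          intro hXS'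
          rw [← hXS', Finset.union_idempotent] at hsub
          exact hXne (hmax X hXS hsub)
      · rintro (hS | ⟨⟨_, hS𝒜⟩, _, hsub⟩)
        · rw [hS]; exact ⟨hX₀𝒜, Finset.subset_union_right⟩
        · exact ⟨hS𝒜, hsub⟩
    rw [hEq, Finset.card_insert_of_notMem (fun h => (Finset.mem_filter.1 h).1 |> fun h' => by
      rw [hV] at h'; exact Finset.notMem_erase X₀ 𝒜 h')]
    exact hXeven.add_one

end KernelPeeling

end Summit.CriticalPhenomena.PercolationContinuityZ3.Theorems
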